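import Summits.AtomisticToContinuum.HydrodynamicLimit.Theorems.AntiMazurCoboundariesKineticWindowGronwallThermalScalingFlow
import Summits.AtomisticToContinuum.HydrodynamicLimit.Theorems.AntiMazurCoboundariesKineticWindowGronwallThermalScalingGibbs
import Summits.AtomisticToContinuum.HydrodynamicLimit.Theses.TwoClocks

/-!
# `EquilibriumShearWindowLD`: thermal normal form — unit temperature and unit activity
# (route TwoClocks, stmt-AtomisticToContinuum-14446; time–velocity scaling of hard-sphere dynamics)

Helper file (`--supports` stmt-AtomisticToContinuum-14446). Write
`M_N^{(a₀,θ₀)}(β, τ; φ)[Φ] = ∫ exp(β Σᵢ w⁻¹∫₀ʷ φ(xᵢ(r)) vᵢ⁰(r) vᵢ¹(r) dr) dG_N(a₀, 0, θ₀)`, `w = τ(N+1)^{-1/3}`,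
for the window exponential moment of the kinetic shear stress of the item
`TwoClocks.EquilibriumShearWindowLD` along the flow `Φ`. Hard-sphere dynamics has no intrinsic time
scale: `v ↦ v/√θ₀`, `t ↦ √θ₀ t` maps hard-sphere trajectories to hard-sphere trajectories of the
same diameter (the rescaled flow `thermalScale Φ (√θ₀)⁻¹ _` of
`KineticWindowGronwallThermalScaling`, built on `IsHardSphereTrajectory.timeDilate`), and maps the
centred homogeneous Gibbs law at temperature `θ₀` to the one at temperature `1`
(`lintegral_localGibbsLaw_thermal`). For the item's functional (quadratic in the velocities, time
AVERAGED) this gives the exact dictionary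

* `shearWindowSum_thermalScale_scaleVel` — pathwise:
  `W_w[Φ^{(c)}](scaleVel c z) = c² · W_{cw}[Φ](z)` (`c > 0`);
* `shearWindowMoment_thermal` — **`M_N^{(a₀,θ₀)}(β, τ; φ)[Φ] = M_N^{(a₀,1)}(β θ₀, √θ₀ τ; φ)[Φ^{((√θ₀)⁻¹)}]`**:
  temperature `θ₀` at tilt `β` and window `τ` is temperature `1` at tilt `βθ₀` and window `√θ₀ τ`;
* `equilibriumShearWindowLD_iff_unit_temperature` — hence **the item is equivalent to its instance
  at `θ₀ = 1` and `a₀ = 1`** (the activity cancels from the canonical density,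
  `localGibbsLaw_const_activity`): the only parameters left are the reduced diameter `σ`, the flow
  family and the test function `φ` (and, by the companion normal forms, one tilt per `φ` and any
  one flow family).

Nothing dynamical is proved: the item (the `u₀ = 0`, `F = φ v⁰v¹` instance of the open crux
`EquilibriumFastWindowLD`, stmt-14440) stays open; this file removes the temperature and the
activity from what has to be shown and records the scaling `Λ_τ^{θ₀}(β) = Λ_{√θ₀ τ}^{1}(β θ₀)` of its
window pressure.

References: D. Serre, C. R. Math. Acad. Sci. Paris 362 (2024) 1425, §5 (the scaling `τ = μt`,
`v ↦ μv`); I. Gallagher, L. Saint-Raymond, B. Texier, *From Newton to Boltzmann* (2013), §4.1.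

prover-pitem-stmt-AtomisticToContinuum-14446-c4-0.
-/

noncomputable section

open MeasureTheory Real Set
open scoped ENNReal

namespace Summit.AtomisticToContinuum.HydrodynamicLimit.Theorems

open Literature.Analysis.FluidPDE Literature.MathematicalPhysics.KineticTheory
open Summit.AtomisticToContinuum.HydrodynamicLimit.Theses.TwoClocks
open KineticWindowGronwallThermalScaling

variable {σ : ℝ} {N : ℕ}

/-! ### Pathwise dictionary -/

/-- **The shear window functional along the rescaled flow** (`c > 0`, any window `w`, every `z`):
`Σᵢ w⁻¹∫₀ʷ φ vⁱ⁰vⁱ¹ [Φ^{(c)}_r (scaleVel c z)] dr = c² · Σᵢ (cw)⁻¹∫₀^{cw} φ vⁱ⁰vⁱ¹ [Φ_r z] dr`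
(`Φ^{(c)}_r ∘ scaleVel c = scaleVel c ∘ Φ_{cr}`, the substitution `r ↦ cr`, and homogeneity of
degree two of `v ↦ v⁰v¹`). No integrability is needed. [folklore] -/
theorem shearWindowSum_thermalScale_scaleVel
    (Φ : HardSphereFlow (Torus.geometry (Fin 3)) (hsDiameter σ N) (N + 1)) {c : ℝ} (hc : 0 < c)
    (φ : T3 → ℝ) (w : ℝ) (z : Config (N + 1) (Fin 3) T3) :
    ∑ i, w⁻¹ * ∫ r in (0 : ℝ)..w,
        φ ((thermalScale Φ c hc).flow r (scaleVel c z) i).1 *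
          (((thermalScale Φ c hc).flow r (scaleVel c z) i).2 0 *
            ((thermalScale Φ c hc).flow r (scaleVel c z) i).2 1) =
      c ^ 2 * ∑ i, (c * w)⁻¹ * ∫ r in (0 : ℝ)..(c * w),
        φ (Φ.flow r z i).1 * ((Φ.flow r z i).2 0 * (Φ.flow r z i).2 1) := by
  rw [Finset.mul_sum]
  refine Finset.sum_congr rfl fun i _ => ?_
  have key := intervalIntegral_conj_flow Φ (thermalScale Φ c hc) hc.ne' (fun _ _ => rfl)
    (fun w' : Config (N + 1) (Fin 3) T3 => φ (w' i).1 * ((w' i).2 0 * (w' i).2 1)) z 0 w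
  rw [key, mul_zero, smul_eq_mul]
  simp only [scaleVel_apply, PiLp.smul_apply, smul_eq_mul]
  have hint : ∫ r in (0 : ℝ)..(c * w), φ (Φ.flow r z i).1 * (c * (Φ.flow r z i).2 0 *
      (c * (Φ.flow r z i).2 1)) =
      c ^ 2 * ∫ r in (0 : ℝ)..(c * w), φ (Φ.flow r z i).1 * ((Φ.flow r z i).2 0 * (Φ.flow r z i).2 1) := by
    rw [← intervalIntegral.integral_const_mul]
    congr 1
    funext r
    ring
  rw [hint, mul_inv]
  field_simp

/-! ### The dictionary for the window exponential moment -/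

/-- **Thermal dictionary for the window moment of the kinetic shear stress.** For every activity
`a₀`, temperature `θ₀ > 0`, flow `Φ`, test function `φ`, tilt `β` and window parameter `τ`:
`M_N^{(a₀,θ₀)}(β, τ; φ)[Φ] = M_N^{(a₀,1)}(βθ₀, √θ₀ τ; φ)[thermalScale Φ (√θ₀)⁻¹ _]`
(`lintegral_localGibbsLaw_thermal`: `(scaleVel (√θ₀)⁻¹)_# G_N(a₀,0,θ₀) = G_N(a₀,0,1)`, and the
pathwise dictionary `shearWindowSum_thermalScale_scaleVel` with `c = (√θ₀)⁻¹`, `c² θ₀ = 1`,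
`c · √θ₀ τ = τ`). [folklore] -/
theorem shearWindowMoment_thermal (a₀ : ℝ) {θ₀ : ℝ} (hθ : 0 < θ₀)
    (Φ : HardSphereFlow (Torus.geometry (Fin 3)) (hsDiameter σ N) (N + 1))
    (φ : T3 → ℝ) (β τ : ℝ) :
    ∫⁻ z, ENNReal.ofReal (Real.exp (β * ∑ i : Fin (N + 1),
        (τ * ((N : ℝ) + 1) ^ (-(1 / 3 : ℝ)))⁻¹ *
          ∫ r in (0 : ℝ)..(τ * ((N : ℝ) + 1) ^ (-(1 / 3 : ℝ))),
            φ (Φ.flow r z i).1 * ((Φ.flow r z i).2 0 * (Φ.flow r z i).2 1)))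
        ∂(localGibbsLaw σ (fun _ => a₀) (fun _ => 0) (fun _ => θ₀) N Φ) =
      ∫⁻ z, ENNReal.ofReal (Real.exp ((β * θ₀) * ∑ i : Fin (N + 1),
        ((Real.sqrt θ₀ * τ) * ((N : ℝ) + 1) ^ (-(1 / 3 : ℝ)))⁻¹ *
          ∫ r in (0 : ℝ)..((Real.sqrt θ₀ * τ) * ((N : ℝ) + 1) ^ (-(1 / 3 : ℝ))),
            φ ((thermalScale Φ (Real.sqrt θ₀)⁻¹ (inv_pos.2 (Real.sqrt_pos.2 hθ))).flow r z i).1 *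
              (((thermalScale Φ (Real.sqrt θ₀)⁻¹ (inv_pos.2 (Real.sqrt_pos.2 hθ))).flow r z i).2 0 *
                ((thermalScale Φ (Real.sqrt θ₀)⁻¹ (inv_pos.2 (Real.sqrt_pos.2 hθ))).flow r z i).2 1)))
        ∂(localGibbsLaw σ (fun _ => a₀) (fun _ => 0) (fun _ => (1 : ℝ)) N
            (thermalScale Φ (Real.sqrt θ₀)⁻¹ (inv_pos.2 (Real.sqrt_pos.2 hθ)))) := by
  set c : ℝ := (Real.sqrt θ₀)⁻¹ with hc_def
  have hc : 0 < c := inv_pos.2 (Real.sqrt_pos.2 hθ)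
  have hs : Real.sqrt θ₀ ≠ 0 := (Real.sqrt_pos.2 hθ).ne'
  have h := lintegral_localGibbsLaw_thermal σ a₀ hθ 0 N Φ (thermalScale Φ c hc)
    (fun z => ENNReal.ofReal (Real.exp ((β * θ₀) * ∑ i : Fin (N + 1),
        ((Real.sqrt θ₀ * τ) * ((N : ℝ) + 1) ^ (-(1 / 3 : ℝ)))⁻¹ *
          ∫ r in (0 : ℝ)..((Real.sqrt θ₀ * τ) * ((N : ℝ) + 1) ^ (-(1 / 3 : ℝ))),
            φ ((thermalScale Φ c hc).flow r z i).1 *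
              (((thermalScale Φ c hc).flow r z i).2 0 * ((thermalScale Φ c hc).flow r z i).2 1))))
  simp only [smul_zero] at h
  rw [h]
  refine lintegral_congr fun z => ?_
  rw [shearWindowSum_thermalScale_scaleVel Φ hc φ _ z]
  have hcw : c * ((Real.sqrt θ₀ * τ) * ((N : ℝ) + 1) ^ (-(1 / 3 : ℝ))) =
      τ * ((N : ℝ) + 1) ^ (-(1 / 3 : ℝ)) := by
    rw [hc_def, ← mul_assoc, ← mul_assoc, inv_mul_cancel₀ hs, one_mul]
  have hβ : (β * θ₀) * c ^ 2 = β := by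
    rw [hc_def, mul_assoc, mul_comm θ₀, inv_sqrt_sq_mul hθ, mul_one]
  rw [hcw, ← mul_assoc, hβ]

/-! ### The normal form -/

/-- **Thermal normal form of `EquilibriumShearWindowLD`** (stmt-AtomisticToContinuum-14446): the
item is equivalent to its instance at UNIT TEMPERATURE and UNIT ACTIVITY —
`∃ σ₀ > 0 ∀ σ ∈ (0, σ₀) ∀ Φ ∀ φ continuous ∃ β₀ > 0 ∀ |β| ≤ β₀ ∀ ε > 0 ∃ τ > 0 ∃ N₀ ∀ N ≥ N₀,
M_N^{(1,1)}(β, τ; φ)[Φ] ≤ exp(ε(N+1))`. (`→`: specialise `a₀ = θ₀ = 1`. `←`: the activity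
cancels, `localGibbsLaw_const_activity`; given `θ₀` and `Φ`, apply the hypothesis to the
thermally rescaled family `N ↦ thermalScale (Φ N) (√θ₀)⁻¹ _` — a flow family of the same
diameters — with tilt range `β₀/θ₀` and window `τ/√θ₀`, and transfer by `shearWindowMoment_thermal`.)
The dynamical content of the item is untouched. [folklore] -/
theorem equilibriumShearWindowLD_iff_unit_temperature :
    EquilibriumShearWindowLD ↔
      ∃ σ₀ : ℝ, 0 < σ₀ ∧ ∀ σ : ℝ, 0 < σ → σ < σ₀ →
        ∀ Φ : (N : ℕ) → HardSphereFlow (Torus.geometry (Fin 3)) (hsDiameter σ N) (N + 1),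
        ∀ φ : T3 → ℝ, Continuous φ → ∃ β₀ : ℝ, 0 < β₀ ∧ ∀ β : ℝ, |β| ≤ β₀ → ∀ ε : ℝ, 0 < ε →
          ∃ τ : ℝ, 0 < τ ∧ ∃ N₀ : ℕ, ∀ N : ℕ, N₀ ≤ N →
            ∫⁻ z, ENNReal.ofReal (Real.exp (β * ∑ i : Fin (N + 1),
                (τ * ((N : ℝ) + 1) ^ (-(1 / 3 : ℝ)))⁻¹ *
                  ∫ r in (0 : ℝ)..(τ * ((N : ℝ) + 1) ^ (-(1 / 3 : ℝ))),
                    φ ((Φ N).flow r z i).1 * (((Φ N).flow r z i).2 0 * ((Φ N).flow r z i).2 1)))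
                ∂(localGibbsLaw σ (fun _ => (1 : ℝ)) (fun _ => 0) (fun _ => (1 : ℝ)) N (Φ N)) ≤
              ENNReal.ofReal (Real.exp (ε * ((N : ℝ) + 1))) := by
  constructor
  · rintro ⟨σ₀, hσ₀, h⟩
    exact ⟨σ₀, hσ₀, fun σ hσ hσσ Φ φ hφ => h 1 1 one_pos one_pos σ hσ hσσ Φ φ hφ⟩
  · rintro ⟨σ₀, hσ₀, h⟩
    refine ⟨σ₀, hσ₀, fun a₀ θ₀ ha hθ σ hσ hσσ Φ φ hφ => ?_⟩
    have hcpos : 0 < (Real.sqrt θ₀)⁻¹ := inv_pos.2 (Real.sqrt_pos.2 hθ)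
    have hs : Real.sqrt θ₀ ≠ 0 := (Real.sqrt_pos.2 hθ).ne'
    set Ψ : (N : ℕ) → HardSphereFlow (Torus.geometry (Fin 3)) (hsDiameter σ N) (N + 1) :=
      fun N => thermalScale (Φ N) (Real.sqrt θ₀)⁻¹ hcpos with hΨ
    obtain ⟨β₁, hβ₁, hβ⟩ := h σ hσ hσσ Ψ φ hφ
    refine ⟨β₁ / θ₀, div_pos hβ₁ hθ, fun β hb ε hε => ?_⟩
    have hbθ : |β * θ₀| ≤ β₁ := by
      rw [abs_mul, abs_of_pos hθ]
      exact (mul_le_mul_of_nonneg_right hb hθ.le).trans_eq (div_mul_cancel₀ β₁ hθ.ne')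
    obtain ⟨τ₁, hτ₁, N₀, hN⟩ := hβ (β * θ₀) hbθ ε hε
    refine ⟨τ₁ / Real.sqrt θ₀, div_pos hτ₁ (Real.sqrt_pos.2 hθ), N₀, fun N hNN => ?_⟩
    have hτ : Real.sqrt θ₀ * (τ₁ / Real.sqrt θ₀) = τ₁ := mul_div_cancel₀ τ₁ hs
    rw [shearWindowMoment_thermal a₀ hθ (Φ N) φ β (τ₁ / Real.sqrt θ₀), hτ,
      KineticWindowGronwallNegative.localGibbsLaw_const_activity ha.ne' σ 1 0 N]
    exact hN N hNN

end Summit.AtomisticToContinuum.HydrodynamicLimit.Theorems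

end
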